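import Literature.AnabelianGeometry.AbsoluteAnabelian.AbsTopIII.BiAnabelianTelecore
import Literature.AnabelianGeometry.AbsoluteAnabelian.AbsTopIII.FrobeniusPictureMLFCompatibility

/-!
# [AbsTopIII] Corollary 3.7 (ii) last sentence, (iii) second clause, (v) final sentence — the LITERAL
# Def 3.5 (ii)/(v) compatibility statements of the bi-anabelian log-Frobenius compatibility

S. Mochizuki, *Topics in Absolute Anabelian Geometry III*, Cor. 3.7 pp. 86–88 of the kurims manuscript
(`paper:url-5493eb38cbb7`; bib key `MochizukiAbsTopIII2015`), read on the page (p. 88); Def. 3.5 (ii)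
("compatible" families: contained in one family) and (v) (compatibility of an equivalence of diagrams with
families) pp. 75–76.  Seat abc-iut-L4-t5 (gen 5).  STATEMENTS ONLY (typed, NOT proved); they close the three
clauses recorded as "NOT typed (docstring)" in abc-iut-L4-t9's `BiAnabelianDiagrams.lean`,
`BiAnabelianIncompatibility.lean`, `BiAnabelianTelecore.lean`, on the pattern of the Cor. 3.6 file
`FrobeniusPictureMLFCompatibility.lean` (`HomotopyFamily.CompatibleAlong` along graph embeddings;
`OneMorphism.CompatibleWith` for (v)):

* (ii), last sentence, p. 88 l. 19–21: "`𝒟* = 𝒟*_{≤4}` admits a natural structure of core on `𝒟*_{≤3}` in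
  a fashion compatible with the core structure of `𝒟†_{≤4}` on `𝒟†_{≤3}` discussed in (i)" —
  `StarCoreCompatStmt`: ONE family on `𝒟*` contains core families for `(𝒟*, 𝔈)` and `(𝒟†_{≤4}, 𝔈)`;
* (iii), second clause, p. 88 l. 36–37: the `𝔖†_log` family "is compatible with the families of homotopies
  that constitute the core and telecore structures of (i), (ii)" — `LogObsCompatCoresStmt` (cores of (i)
  and the `𝒟*`-core of (ii)) and `LogObsCompatTelecoreStmt` (the telecore family of `𝔗_δ`), along the
  embeddings of the presentations into `𝒟*`;
* (v), final sentence, p. 88 l. 52–54: "the self-equivalences in these nexus-classes are compatible with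
  `ℋ_δ` [cf. (ii)], as well as with the families of homotopies that constitute the cores, telecore, and
  observable of (i), (ii), (iii)" — `ShiftCompatStmt θ`.

Every typed (i)/(ii)/(iii)/(v) item of abc-iut-L4-t9 is consumed BY NAME (`galCoreObs`, `refCoreObs`,
`starGalCoreObs`, `logObsDiagram` / `LogPinned` / `ObservableLogStmt`, `IsTelecoreDelta`, `DeltaFamilyStmt`,
`ShiftStmt`); nothing is re-declared.  HONEST FRAMING: refereed pre-IUT material; per-setting `Prop`s,
not asserted; nothing here bears on [IUTchIII] Cor. 3.12.
-/

namespace Literature.AnabelianGeometry.AbsoluteAnabelian.AbsTopIII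

open CategoryTheory Quiver
open Literature.AnabelianGeometry.AbsoluteAnabelian.DiagramOfCategories

universe u

namespace BiAnabelianSetting

variable {X E N : Type u} [Category.{u} X] [Category.{u} E] [Category.{u} N]
  (𝔖 : BiAnabelianSetting X E N)

/-! ### The embeddings of the presentations into `𝒟*` -/

/-- `𝒟†_{≤3}` (presented as `𝒟†_{≤2} ∪ {𝒩}`, `logObsDiagram`) `↪ 𝒟*`: base vertices to themselves, the
observation vertex to `𝒩`, the observation edges to `λ^×, λ^{×pf}`. [cite: MochizukiAbsTopIII2015, Cor 3.7 (iii) p.88] -/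
def embLog : logObsShape.{u}.Vertex ⥤q Cor37Vertex where
  obj a := match a with
    | ExtVertex.base a => a.1
    | ExtVertex.obs => Cor37Vertex.space
  map {a b} e := match a, b, e with
    | ExtVertex.base _, ExtVertex.base _, e => e
    | ExtVertex.base ⟨.box, _⟩, ExtVertex.obs, i =>
        if (ULift.down i : Bool) then Cor37Edge.lamTimes else Cor37Edge.lamTimesPf
    | ExtVertex.base ⟨.first _, _⟩, ExtVertex.obs, i => PEmpty.elim i
    | ExtVertex.base ⟨.space, _⟩, ExtVertex.obs, i => PEmpty.elim i
    | ExtVertex.base ⟨.galois, _⟩, ExtVertex.obs, i => PEmpty.elim i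
    | ExtVertex.base ⟨.ref, _⟩, ExtVertex.obs, i => PEmpty.elim i
    | ExtVertex.obs, ExtVertex.base _, j => PEmpty.elim j
    | ExtVertex.obs, ExtVertex.obs, e => PEmpty.elim e

/-- `𝒟†_{≤4}` (presented as `𝒟†_{≤3} ∪ {𝔈}`) `↪ 𝒟*`: the observation vertex to `𝔈`, its edge to `𝒩 → 𝔈`.
[cite: MochizukiAbsTopIII2015, Cor 3.7 (i) p.87] -/
def embGalCore : galCoreShape.{u}.Vertex ⥤q Cor37Vertex where
  obj a := match a with
    | ExtVertex.base a => a.1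
    | ExtVertex.obs => Cor37Vertex.galois
  map {a b} e := match a, b, e with
    | ExtVertex.base _, ExtVertex.base _, e => e
    | ExtVertex.base ⟨.space, _⟩, ExtVertex.obs, _ => Cor37Edge.toGal
    | ExtVertex.base ⟨.first _, _⟩, ExtVertex.obs, i => PEmpty.elim i
    | ExtVertex.base ⟨.box, _⟩, ExtVertex.obs, i => PEmpty.elim i
    | ExtVertex.base ⟨.galois, _⟩, ExtVertex.obs, i => PEmpty.elim i
    | ExtVertex.base ⟨.ref, _⟩, ExtVertex.obs, i => PEmpty.elim i
    | ExtVertex.obs, ExtVertex.base _, j => PEmpty.elim j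
    | ExtVertex.obs, ExtVertex.obs, e => PEmpty.elim e

/-- `𝒟‡_{≤1}` (presented as `𝒟†_{≤1} ∪ {𝒳}`) `↪ 𝒟*`: the core vertex to `ref`, the edges `π_⋎` to `proj ⋎`.
[cite: MochizukiAbsTopIII2015, Cor 3.7 (i) p.87] -/
def embRefCore : refCoreShape.{u}.Vertex ⥤q Cor37Vertex where
  obj a := match a with
    | ExtVertex.base a => a.1
    | ExtVertex.obs => Cor37Vertex.ref
  map {a b} e := match a, b, e with
    | ExtVertex.base _, ExtVertex.base _, e => e
    | ExtVertex.base ⟨.first n, _⟩, ExtVertex.obs, _ => Cor37Edge.proj n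
    | ExtVertex.base ⟨.box, _⟩, ExtVertex.obs, i => PEmpty.elim i
    | ExtVertex.base ⟨.space, _⟩, ExtVertex.obs, i => PEmpty.elim i
    | ExtVertex.base ⟨.galois, _⟩, ExtVertex.obs, i => PEmpty.elim i
    | ExtVertex.base ⟨.ref, _⟩, ExtVertex.obs, i => PEmpty.elim i
    | ExtVertex.obs, ExtVertex.base _, j => PEmpty.elim j
    | ExtVertex.obs, ExtVertex.obs, e => PEmpty.elim e

/-- `𝒟* = 𝒟*_{≤4}` (presented as `𝒟*_{≤3} ∪ {𝔈}`) `↪ 𝒟*`. [cite: MochizukiAbsTopIII2015, Cor 3.7 (ii) p.88] -/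
def embStarCore : starGalCoreShape.{u}.Vertex ⥤q Cor37Vertex where
  obj a := match a with
    | ExtVertex.base a => a.1
    | ExtVertex.obs => Cor37Vertex.galois
  map {a b} e := match a, b, e with
    | ExtVertex.base _, ExtVertex.base _, e => e
    | ExtVertex.base ⟨.space, _⟩, ExtVertex.obs, _ => Cor37Edge.toGal
    | ExtVertex.base ⟨.first _, _⟩, ExtVertex.obs, i => PEmpty.elim i
    | ExtVertex.base ⟨.box, _⟩, ExtVertex.obs, i => PEmpty.elim i
    | ExtVertex.base ⟨.galois, _⟩, ExtVertex.obs, i => PEmpty.elim i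
    | ExtVertex.base ⟨.ref, _⟩, ExtVertex.obs, i => PEmpty.elim i
    | ExtVertex.obs, ExtVertex.base _, j => PEmpty.elim j
    | ExtVertex.obs, ExtVertex.obs, e => PEmpty.elim e

section Telecore

variable {𝔖}
variable {H : ((𝔖.daggerLe 1).extend 𝔖.refCoreExt).HomotopyFamily}
  {hH : ∀ ⦃a b : refCoreShape.{u}.Vertex⦄ ⦃p q : Path a b⦄, H.E p q → b = refCoreShape.{u}.obs}
  {hc : (𝔖.refCoreObs H hH).IsCore}

/-- The telecore diagram `𝒟‡_δ` of a telecore over the core `(𝒟‡_{≤1}, 𝒳)` `↪ 𝒟*`: base vertices to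
themselves, the core vertex to `ref`, `π_⋎ ↦ proj ⋎`, every telecore edge at `⋎` to `δ_⋎ = diag ⋎` (for a
telecore OF THE PRINTED SHAPE, `IsTelecoreDelta`, there is exactly one such edge per `⋎` with functor `δ_𝒳`;
`𝒟†_{≤1}` has no vertex of row `≥ 2`). [cite: MochizukiAbsTopIII2015, Cor 3.7 (ii) p.87] -/
def embTele (T : (𝔖.daggerLe 1).Telecore (𝔖.refCoreObs H hH) hc) :
    ExtShape.Vertex ⟨refCoreShape.{u}.I, T.J⟩ ⥤q Cor37Vertex where
  obj a := match a with
    | ExtVertex.base a => a.1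
    | ExtVertex.obs => Cor37Vertex.ref
  map {a b} e := match a, b, e with
    | ExtVertex.base _, ExtVertex.base _, e => e
    | ExtVertex.base ⟨.first n, _⟩, ExtVertex.obs, _ => Cor37Edge.proj n
    | ExtVertex.base ⟨.box, _⟩, ExtVertex.obs, i => PEmpty.elim i
    | ExtVertex.base ⟨.space, _⟩, ExtVertex.obs, i => PEmpty.elim i
    | ExtVertex.base ⟨.galois, _⟩, ExtVertex.obs, i => PEmpty.elim i
    | ExtVertex.base ⟨.ref, _⟩, ExtVertex.obs, i => PEmpty.elim i
    | ExtVertex.obs, ExtVertex.base ⟨.first n, _⟩, _ => Cor37Edge.diag n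
    | ExtVertex.obs, ExtVertex.base ⟨.box, h⟩, _ => absurd h.2 (by decide)
    | ExtVertex.obs, ExtVertex.base ⟨.space, h⟩, _ => absurd h.2 (by decide)
    | ExtVertex.obs, ExtVertex.base ⟨.galois, h⟩, _ => absurd h.2 (by decide)
    | ExtVertex.obs, ExtVertex.base ⟨.ref, h⟩, _ => absurd h.1 (by simp [Cor37Vertex.InDagger])
    | ExtVertex.obs, ExtVertex.obs, e => PEmpty.elim e

end Telecore

/-! ### Factorisations of the typed (iii), (v) -/

/-- The family `H` on `𝒟†_{≤3}` IS the observable `𝔖†_log`: generated by the type-(1)/(2) pairs, boundary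
paths ending at `𝒩`, `ι_{log,⋎}`, `ι_×` on the generators (the body of abc-iut-L4-t9's `ObservableLogStmt`).
[cite: MochizukiAbsTopIII2015, Cor 3.7 (iii) p.88] -/
def IsLogObservableFamily (H : 𝔖.logObsDiagram.HomotopyFamily) : Prop :=
  HomotopyFamily.IsGeneratedBy _ H LogGen.{u} ∧
    (∀ ⦃a b : logObsShape.{u}.Vertex⦄ ⦃p q : Path a b⦄, H.E p q → b = logObsShape.{u}.obs) ∧ 𝔖.LogPinned H

/-- `ObservableLogStmt` is "some family is the `𝔖†_log` family" (definitional).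
[cite: MochizukiAbsTopIII2015, Cor 3.7 (iii) p.88] -/
theorem observableLogStmt_iff : 𝔖.ObservableLogStmt ↔ ∃ H, 𝔖.IsLogObservableFamily H := Iff.rfl

/-- `Φ : ℤ → (self-equivalences of 𝒟*)` IS the `ℤ`-action of (v) (the body of abc-iut-L4-t9's `ShiftStmt`).
[cite: MochizukiAbsTopIII2015, Cor 3.7 (v) p.88] -/
def IsShiftAction (Φ : ℤ → 𝔖.starDiagram.SelfEquivalence) : Prop :=
  (∀ m, (Φ m).graphMap = Cor37Vertex.shift m) ∧
    (∀ m, (Φ m).IsNexusClass Cor37Vertex.box {a : Cor37Vertex | a.BelowBox}) ∧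
    (∃ h₀ : (Φ 0).graphMap = 𝟭q Cor37Vertex,
      (h₀ ▸ (Φ 0).hom).Isomorphic (OneMorphism.id 𝔖.starDiagram)) ∧
    (∀ m m' : ℤ, ∃ h : (Φ m).graphMap ⋙q (Φ m').graphMap = (Φ (m + m')).graphMap,
      (h ▸ ((Φ m).hom.comp (Φ m').hom)).Isomorphic (Φ (m + m')).hom)

/-- `ShiftStmt` is "some `Φ` is the `ℤ`-action" (definitional). [cite: MochizukiAbsTopIII2015, Cor 3.7 (v) p.88] -/
theorem shiftStmt_iff : 𝔖.ShiftStmt ↔ ∃ Φ, 𝔖.IsShiftAction Φ := Iff.rfl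

/-! ### Corollary 3.7 (ii), last sentence -/

/-- **Cor. 3.7 (ii), last sentence**: "`𝒟* = 𝒟*_{≤4}` admits a natural structure of core on `𝒟*_{≤3}` in a
fashion compatible with the core structure of `𝒟†_{≤4}` on `𝒟†_{≤3}` discussed in (i)": ONE family of
homotopies on `𝒟*` contains (Def. 3.5 (ii), along the embeddings) a core family for `(𝒟*, 𝔈)` and a core
family for `(𝒟†_{≤4}, 𝔈)`. [cite: MochizukiAbsTopIII2015, Cor 3.7 (ii) p.88] -/
def StarCoreCompatStmt : Prop :=
  ∃ K : 𝔖.starDiagram.HomotopyFamily,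
    (∃ H hH, (𝔖.starGalCoreObs H hH).IsCore ∧ H.CompatibleAlong embStarCore K) ∧
    (∃ H hH, (𝔖.galCoreObs H hH).IsCore ∧ H.CompatibleAlong embGalCore K)

/-! ### Corollary 3.7 (iii), second clause -/

/-- **A family `K` on `𝒟*` realising the cores of (i), (ii) and the observable of (iii)**: `K` contains
(Def. 3.5 (ii), along the embeddings) an `𝔖†_log` family on `𝒟†_{≤3}`, core families for `(𝒟†_{≤4}, 𝔈)`,
`(𝒟‡_{≤1}, 𝒳)` (the cores of (i)) and for `(𝒟*, 𝔈)` (the core of (ii)).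
[cite: MochizukiAbsTopIII2015, Cor 3.7 (iii) p.88] -/
def RealisesCoresAndLogObs (K : 𝔖.starDiagram.HomotopyFamily) : Prop :=
  (∃ H : 𝔖.logObsDiagram.HomotopyFamily, 𝔖.IsLogObservableFamily H ∧ H.CompatibleAlong embLog K) ∧
  (∃ H hH, (𝔖.galCoreObs H hH).IsCore ∧ H.CompatibleAlong embGalCore K) ∧
  (∃ H hH, (𝔖.refCoreObs H hH).IsCore ∧ H.CompatibleAlong embRefCore K) ∧
  (∃ H hH, (𝔖.starGalCoreObs H hH).IsCore ∧ H.CompatibleAlong embStarCore K)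

/-- **Cor. 3.7 (iii), second clause — cores**: the `𝔖†_log` family "is compatible with the families of
homotopies that constitute the core [...] structures of (i), (ii)": ONE family on `𝒟*` contains the `𝔖†_log`
family and the three core families. HONEST WORDING (abc-iut-w6-d023's datum for Cor. 3.6 (iii), adopted by
abc-iut-L4-lead RULING #8j, carried over): this LITERAL Def. 3.5 (ii) clause ("contained in one family") is
strictly WEAKER than an `IotaOverGalois`-type statement (F-0360 `IotaOverGaloisStmt` for Cor. 3.6, whose
universal closure is refuted and which holds at named instances only); nothing here asserts such a statement.
[cite: MochizukiAbsTopIII2015, Cor 3.7 (iii) p.88] -/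
def LogObsCompatCoresStmt : Prop := ∃ K : 𝔖.starDiagram.HomotopyFamily, 𝔖.RealisesCoresAndLogObs K

/-- **Cor. 3.7 (iii), second clause — telecore**: the `𝔖†_log` family "is compatible with the families of
homotopies that constitute the [...] telecore structures of [...] (ii)": over a telecore `𝔗_δ` of the printed
shape (`IsTelecoreDelta`), ONE family on `𝒟*` contains (along the embeddings `𝒟‡_δ ↪ 𝒟*`, `𝒟†_{≤3} ↪ 𝒟*`)
the telecore family `𝒥` and the `𝔖†_log` family (same HONEST WORDING as `LogObsCompatCoresStmt`: the literal
clause, strictly weaker than an F-0360-type statement). [cite: MochizukiAbsTopIII2015, Cor 3.7 (iii) p.88] -/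
def LogObsCompatTelecoreStmt : Prop :=
  ∃ H₁ hH₁ hc, ∃ T : (𝔖.daggerLe 1).Telecore (𝔖.refCoreObs H₁ hH₁) hc, 𝔖.IsTelecoreDelta T ∧
    ∃ K : 𝔖.starDiagram.HomotopyFamily, T.Jfam.CompatibleAlong (embTele T) K ∧
      ∃ H : 𝔖.logObsDiagram.HomotopyFamily, 𝔖.IsLogObservableFamily H ∧ H.CompatibleAlong embLog K

/-! ### Corollary 3.7 (v), final sentence -/

/-- **A family `K` on `𝒟*` realising `ℋ_δ`, the cores, the telecore and the observable**: `K` realises the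
cores and `𝔖†_log` (`RealisesCoresAndLogObs`), contains (along `𝒟‡_δ ↪ 𝒟*`) the family `𝒥` of a telecore
`𝔗_δ` of the printed shape, and contains a family `ℋ_δ` on `𝒟*` generated by `DeltaGen` with the printed
homotopies (`DeltaPinned θ`, the body of abc-iut-L4-t9's `DeltaFamilyStmt θ`).
[cite: MochizukiAbsTopIII2015, Cor 3.7 (v) p.88] -/
def RealisesAll (θ : FiberSquare.BiAnabelianLift 𝔖.gal) (K : 𝔖.starDiagram.HomotopyFamily) : Prop :=
  𝔖.RealisesCoresAndLogObs K ∧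
    (∃ H₁ hH₁ hc, ∃ T : (𝔖.daggerLe 1).Telecore (𝔖.refCoreObs H₁ hH₁) hc,
      𝔖.IsTelecoreDelta T ∧ T.Jfam.CompatibleAlong (embTele T) K) ∧
    (∃ Hδ : 𝔖.starDiagram.HomotopyFamily, HomotopyFamily.IsGeneratedBy _ Hδ DeltaGen.{u} ∧
      𝔖.DeltaPinned θ Hδ ∧ Hδ.CompatibleAlong (𝟭q Cor37Vertex) K)

/-- **Cor. 3.7 (v), final sentence**: "the self-equivalences in these nexus-classes are compatible with
`ℋ_δ` [cf. (ii)], as well as with the families of homotopies that constitute the cores, telecore, and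
observable of (i), (ii), (iii)": for the `ℤ`-action `Φ` of (v) and a family `K` on `𝒟*` realising all of them,
every `Φ_m` is compatible with `K` in the sense of Def. 3.5 (v) (abc-iut-L4-t2's `OneMorphism.CompatibleWith`).
[cite: MochizukiAbsTopIII2015, Cor 3.7 (v) p.88] -/
def ShiftCompatStmt (θ : FiberSquare.BiAnabelianLift 𝔖.gal) : Prop :=
  ∃ (Φ : ℤ → 𝔖.starDiagram.SelfEquivalence) (K : 𝔖.starDiagram.HomotopyFamily),
    𝔖.IsShiftAction Φ ∧ 𝔖.RealisesAll θ K ∧ ∀ m : ℤ, Nonempty ((Φ m).hom.CompatibleWith K K)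

end BiAnabelianSetting

end Literature.AnabelianGeometry.AbsoluteAnabelian.AbsTopIII
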